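import Literature.Geometry.Lorentzian.NormalisedMaximalFoliation
import Literature.Geometry.Lorentzian.MinkowskiCauchyDevelopment
import Literature.Geometry.Lorentzian.TrivialDataAdmissible
import Literature.Geometry.Lorentzian.CauchyHypersurfaceTransfer
import Literature.Geometry.Lorentzian.AsymptoticFlatnessProofs
import Literature.Geometry.Lorentzian.ChartCalculus
import Literature.Topology.FourManifolds.ClosedBallProofs
import Summits.FinalStateConjecture.FinalStateConjecture.Theses.LapseTrumpetKID
import Summits.FinalStateConjecture.FinalStateConjecture.Theorems.PhotonSphereChannelsChannelsResolveTameDevelopmentsRMinkowskiMaximal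
import HarnessLib

/-!
# Anti-vacuity of the crux `SettlingInMaximalGauge` (stmt-FinalStateConjecture-17999):
# the standard foliation of Minkowski space is a normalised maximal Cauchy foliation with
# (vacuously) trapped lapse wells, and the crux holds at the Minkowski development

Refuter evidence (route `LapseTrumpetKID`, crux-attack vetting cycle, 2026-08-17).

The hypothesis block of the crux quantifies over the NEW Literature predicates
`Spacetime.IsNormalisedMaximalFoliation` / `Spacetime.HasTrappedWells`
(`NormalisedMaximalFoliation.lean`, vendored for this route; no inhabitant in the tree so far).
This file certifies that they are satisfiable, at a certified vacuum Cauchy development of an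
admissible datum, by the intended object:

* `stdFoliation : ℝ × slice → E4`, `(t, y) ↦ (t, y)` with normals `∂ₜ` is a normalised maximal
  Cauchy foliation of Minkowski space (`isNormalisedMaximalFoliation_std`): jointly smooth; every
  leaf `y ↦ (t, y)` a smooth embedding (translate of the slice embedding) onto the Cauchy
  hypersurface `{x⁰ = t}` (transport of `{x⁰ = 0}` along the time translation, an isometry
  preserving `∂ₜ`); `∂ₜ` the future unit normal; induced data the trivial data `(δ, 0)` (maximal,
  complete, asymptotically flat of order `1` on the sole end `{1 < ‖y‖}`); lapse `≡ 1`.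
* its lapse wells are trapped (`hasTrappedWells_std`, vacuously: the lapse never drops below
  `1/2`);
* the crux's matrix holds at the Minkowski development for every `(F, ν)`
  (`settlingInMaximalGauge_minkowski`, from the tree theorem `settlesT2_minkowski`), and all its
  hypotheses AND its conclusion hold together at one certified MGHD given the
  Choquet-Bruhat–Geroch fact (`cruxHypotheses_minkowski`).

Sorry-free; standard axioms. Hawking–Ellis 1973, §5.1 and §6.5 (the surfaces `{x⁴ = const}` are
Cauchy surfaces of Minkowski space); Christodoulou–Klainerman 1993, Introduction (1.0.1),
(1.0.10)–(1.0.13) (maximal foliation, lapse, normal foliation condition).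
-/

noncomputable section

open Set Filter Function TopologicalSpace
open scoped Manifold ContDiff Topology

namespace Summit.FinalStateConjecture.FinalStateConjecture.Theorems.SettlingInMaximalGauge.Negative

set_option linter.dupNamespace false

open Literature.Geometry.Lorentzian Literature.Geometry.Lorentzian.Minkowski

/-! ### The standard foliation of Minkowski space and the time translations -/

/-- The **standard foliation** of Minkowski space by the hyperplanes `{x⁰ = t}`:
`F(t, y) = (t, y)`. Hawking–Ellis 1973, §5.1. [cite: HawkingEllis1973, §5.1] -/
def stdFoliation : ℝ × slice → E4 := fun p ↦ E4.ofTimeSpace p.1 (p.2 : E3)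

/-- The normals of the standard foliation: the constant field `∂ₜ` along every leaf.
Hawking–Ellis 1973, §5.1. [cite: HawkingEllis1973, §5.1] -/
def stdNormals (t : ℝ) : NormalField (𝓡 4) (fun y : slice ↦ stdFoliation (t, y)) :=
  fun _ ↦ E4.basisVector 0

/-- Unfolding lemma: `F(t, y) = (t, y)`. [folklore] -/
@[simp]
theorem stdFoliation_apply (t : ℝ) (y : slice) :
    stdFoliation (t, y) = E4.ofTimeSpace t (y : E3) := rfl

/-- Unfolding lemma: the normal of every leaf at every point is `∂ₜ`. [folklore] -/
@[simp]
theorem stdNormals_apply (t : ℝ) (y : slice) : stdNormals t y = E4.basisVector 0 := rfl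

/-- The leaf `y ↦ (t, y)` is the translate by `t ∂ₜ` of the slice embedding `y ↦ (0, y)`.
[folklore] -/
theorem leaf_eq_sliceEmbed_add (t : ℝ) (y : slice) :
    stdFoliation (t, y) = sliceEmbed y + t • E4.basisVector 0 := by
  rw [stdFoliation_apply, E4.ofTimeSpace_eq_smul_add, sliceEmbed_apply, add_comm]

/-- The time coordinate of `F(t, y)` is `t`. [folklore] -/
@[simp]
theorem stdFoliation_apply_zero (t : ℝ) (y : slice) : stdFoliation (t, y) 0 = t := by
  simp [stdFoliation]

/-- The **time translation** `x ↦ x + t ∂ₜ` of `E4`, as a `C^∞` diffeomorphism. [folklore] -/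
def timeTranslation (t : ℝ) : E4 ≃ₘ^∞⟮𝓘(ℝ, E4), 𝓘(ℝ, E4)⟯ E4 where
  toEquiv := Equiv.addRight (t • E4.basisVector 0)
  contMDiff_toFun := contMDiff_iff_contDiff.2 (contDiff_id.add contDiff_const)
  contMDiff_invFun := contMDiff_iff_contDiff.2 (contDiff_id.add contDiff_const)

/-- Unfolding lemma: `timeTranslation t x = x + t ∂ₜ`. [folklore] -/
@[simp]
theorem timeTranslation_apply (t : ℝ) (x : E4) :
    timeTranslation t x = x + t • E4.basisVector 0 := rfl

/-- The differential of a time translation is the identity. [folklore] -/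
theorem mfderiv_timeTranslation (t : ℝ) (x : E4) :
    mfderiv 𝓘(ℝ, E4) 𝓘(ℝ, E4) (timeTranslation t) x = ContinuousLinearMap.id ℝ E4 := by
  have h : (timeTranslation t : E4 → E4) = fun x ↦ x + t • E4.basisVector 0 := rfl
  rw [h, mfderiv_eq_fderiv, fderiv_add_const, fderiv_fun_id]

/-- Time translations are isometric immersions of Minkowski space into itself. [folklore] -/
theorem isIsometricImmersion_timeTranslation (t : ℝ) :
    smoothMetric.IsIsometricImmersion smoothMetric.toPseudoRiemannianMetric (timeTranslation t) := by
  refine ⟨(timeTranslation t).contMDiff, fun y ↦ ?_⟩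
  ext v w
  rw [pullbackBilin_apply, mfderiv_timeTranslation]
  rfl

/-- Time translations preserve the time orientation `∂ₜ`. [folklore] -/
theorem preservesTimeOrientation_timeTranslation (t : ℝ) :
    (timeOrientation.ofLE (n' := ∞) le_top).PreservesTimeOrientation (timeTranslation t)
      (timeOrientation.ofLE (n' := ∞) le_top) := by
  intro y
  rw [mfderiv_timeTranslation]
  exact (timeOrientation.ofLE (n' := ∞) le_top).isFutureDirected_vectorField (timeTranslation t y)


/-! ### The leaves: smooth embeddings onto the Cauchy hypersurfaces `{x⁰ = t}` -/

/-- The leaf `y ↦ (t, y)` is the time translate of the slice embedding. [folklore] -/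
theorem leaf_eq_comp (t : ℝ) :
    (fun y : slice ↦ stdFoliation (t, y)) = timeTranslation t ∘ sliceEmbed :=
  funext fun y ↦ leaf_eq_sliceEmbed_add t y

/-- Every leaf `y ↦ (t, y)` is a smooth embedding of the slice into `E4` (a smooth embedding
followed by a diffeomorphism). Hawking–Ellis 1973, §2.3 and §5.1. [cite: HawkingEllis1973, §5.1] -/
theorem isSmoothEmbedding_leaf (t : ℝ) :
    Manifold.IsSmoothEmbedding (𝓡 3) (𝓡 4) ∞ (fun y : slice ↦ stdFoliation (t, y)) := by
  rw [leaf_eq_comp]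
  exact isSmoothEmbedding_sliceEmbed_holds.diffeomorph_comp (timeTranslation t)

/-- The range of the leaf `y ↦ (t, y)` is the hyperplane `{x⁰ = t}`, the preimage of `{x⁰ = 0}`
under the time translation by `-t`. [folklore] -/
theorem range_leaf (t : ℝ) :
    range (fun y : slice ↦ stdFoliation (t, y)) = timeTranslation (-t) ⁻¹' range sliceEmbed := by
  ext x
  simp only [mem_range, mem_preimage, timeTranslation_apply]
  rw [show (∃ y : slice, sliceEmbed y = x + -t • E4.basisVector 0) ↔
      x + -t • E4.basisVector 0 ∈ range sliceEmbed from Iff.rfl, E4.mem_range_sliceEmbed_iff]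
  constructor
  · rintro ⟨y, rfl⟩
    simp
  · intro hx
    refine ⟨⟨E4.spatial x, mem_slice _⟩, ?_⟩
    have hx0 : x 0 = t := by
      have : (x + -t • E4.basisVector 0) 0 = x 0 - t := by simp; ring
      rw [this] at hx
      linarith
    rw [stdFoliation_apply, ← hx0]
    exact E4.ofTimeSpace_time_spatial x

/-- **Every leaf `{x⁰ = t}` is a Cauchy hypersurface of Minkowski space**: transport of the
Cauchy hypersurface `{x⁰ = 0}` (`Minkowski.isCauchyHypersurface_range_sliceEmbed`) along the time
translation by `-t`, a time-orientation preserving isometry with continuous inverse the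
translation by `t`. Hawking–Ellis 1973, §6.5, p. 205 ("the surfaces `{x⁴ = constant}` are
examples of Cauchy surfaces"). [cite: HawkingEllis1973, §6.5 p. 205] -/
theorem isCauchyHypersurface_leaf (t : ℝ) :
    smoothMetric.IsCauchyHypersurface (timeOrientation.ofLE (n' := ∞) le_top)
      (range fun y : slice ↦ stdFoliation (t, y)) := by
  rw [range_leaf]
  refine isCauchyHypersurface_range_sliceEmbed.preimage_of_isIsometricImmersion (by simp)
    (isIsometricImmersion_timeTranslation (-t)) (preservesTimeOrientation_timeTranslation (-t))
    (Ψ := timeTranslation t) (timeTranslation t).continuous fun x ↦ ?_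
  simp [add_assoc]

/-- The differential of the leaf `y ↦ (t, y)` is `v ↦ (0, v)` (the leaf differs from the slice
embedding by a constant). [folklore] -/
theorem mfderiv_leaf_apply (t : ℝ) (y : slice) (v : E3) :
    mfderiv (𝓡 3) (𝓡 4) (fun y : slice ↦ stdFoliation (t, y)) y v = E4.ofTimeSpace 0 v := by
  set L : E3 →L[ℝ] E4 :=
    LinearMap.toContinuousLinearMap (IsLinearMap.mk' _ isLinearMap_ofTimeSpace_zero) with hL
  have hcoe : (L : E3 → E4) = E4.ofTimeSpace 0 := rfl
  have hrep : ∀ z : slice, stdFoliation (t, z) = (fun w : E3 ↦ L w + t • E4.basisVector 0) z := by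
    intro z
    rw [leaf_eq_sliceEmbed_add, sliceEmbed_apply, hcoe]
  have hd : DifferentiableAt ℝ (fun w : E3 ↦ L w + t • E4.basisVector 0) (y : E3) :=
    L.differentiableAt.add_const _
  change mfderiv 𝓘(ℝ, E3) 𝓘(ℝ, E4) (fun y : slice ↦ stdFoliation (t, y)) y v = _
  rw [OpensChart.mfderiv_eq y _ _ hrep hd, fderiv_add_const, L.fderiv]
  rfl

/-- `∂ₜ` is the future unit normal of every leaf `y ↦ (t, y)`: `η(∂ₜ, (0, v)) = 0`,
`η(∂ₜ, ∂ₜ) = -1`, `∂ₜ` is the orienting field. Wald 1984, §10.2. [cite: Wald1984, §10.2] -/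
theorem isFutureUnitNormal_leaf (t : ℝ) :
    smoothMetric.IsFutureUnitNormal (𝓡 3) (timeOrientation.ofLE (n' := ∞) le_top)
      (fun y : slice ↦ stdFoliation (t, y)) (stdNormals t) := by
  refine ⟨⟨fun y v ↦ ?_, fun y ↦ ?_⟩, fun y ↦ ?_⟩
  · rw [smoothMetric_val, stdNormals_apply, mfderiv_leaf_apply]
    exact bilin_basisVector_zero_ofTimeSpace_zero v
  · rw [smoothMetric_val, stdNormals_apply]
    exact bilin_basisVector_zero
  · exact (timeOrientation.ofLE (n' := ∞) le_top).isFutureDirected_vectorField (stdFoliation (t, y))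

/-! ### The induced data of every leaf are the trivial data `(δ, 0)` -/

/-- The metric induced by `η` on the leaf `y ↦ (t, y)` is `δ`:
`η((0, v), (0, w)) = ⟪v, w⟫`. Wald 1984, (10.2.11). [cite: Wald1984, (10.2.11)] -/
theorem leaf_induced_h (t : ℝ) (y : slice) (v w : TangentSpace (𝓡 3) y) :
    trivialData.h.inner y v w =
      smoothMetric.val (stdFoliation (t, y))
        (mfderiv (𝓡 3) (𝓡 4) (fun z : slice ↦ stdFoliation (t, z)) y v)
        (mfderiv (𝓡 3) (𝓡 4) (fun z : slice ↦ stdFoliation (t, z)) y w) := by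
  rw [smoothMetric_val, trivialData_h_inner, mfderiv_leaf_apply, mfderiv_leaf_apply]
  exact (bilin_ofTimeSpace_zero v w).symm

/-- `∂ₜ` is parallel along every leaf: `D_v ∂ₜ = 0` (constant field, flat connection).
Wald 1984, §10.2, (10.2.13) with §3.1, (3.1.30). [cite: Wald1984, §10.2 (10.2.13)] -/
theorem normalDerivAlong_stdNormals [smoothMetric.toPseudoRiemannianMetric.HasLeviCivita]
    (t : ℝ) (y : slice) (v : TangentSpace (𝓡 3) y) :
    smoothMetric.toPseudoRiemannianMetric.normalDerivAlong (fun z : slice ↦ stdFoliation (t, z))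
      (stdNormals t) y v = 0 := by
  unfold PseudoRiemannianMetric.normalDerivAlong
  exact ModelSpace.covariantDerivAlong_const (g := smoothMetric.toPseudoRiemannianMetric)
    (G₀ := bilin) smoothMetric_val ((fun z : slice ↦ stdFoliation (t, z)) ∘ curveThrough (𝓡 3) y v)
    (E4.basisVector 0) 0

/-- Every leaf is totally geodesic: its second fundamental form with respect to `∂ₜ` is the
tensor `k = 0` of the trivial data. Wald 1984, §10.2, (10.2.13). [cite: Wald1984, §10.2 (10.2.13)] -/
theorem leaf_induced_k [smoothMetric.toPseudoRiemannianMetric.HasLeviCivita] (t : ℝ) (y : slice) :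
    smoothMetric.toPseudoRiemannianMetric.secondFundamentalForm (𝓡 3)
      (fun z : slice ↦ stdFoliation (t, z)) (stdNormals t) y = trivialData.kBilin y := by
  have h0 : smoothMetric.toPseudoRiemannianMetric.secondFundamentalForm (𝓡 3)
      (fun z : slice ↦ stdFoliation (t, z)) (stdNormals t) y = 0 := by
    unfold PseudoRiemannianMetric.secondFundamentalForm
    simp only [normalDerivAlong_stdNormals, map_zero, ContinuousLinearMap.toLinearMap_zero,
      LinearMap.zero_comp]
    exact map_zero _
  rw [h0]
  exact (LinearMap.ext₂ fun v w ↦ by simp).symm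

/-- The trivial data are asymptotically flat of order `1` on the end `trivialAFEnd` (CK rates
with mass `0` ⇒ DR rates ⇒ order `1`). Bartnik 1986, Def. 2.1. [cite: Bartnik1986, Def. 2.1] -/
theorem isAsymptoticallyFlat_one_trivialData : trivialAFEnd.IsAsymptoticallyFlat trivialData 1 :=
  AFEnd.IsStronglyAsymptoticallyFlatDR.IsAsymptoticallyFlat_one_holds trivialAFEnd trivialData
    trivialAFEnd_isStronglyAsymptoticallyFlatCK_holds.isStronglyAsymptoticallyFlatDR

/-! ### Smoothness of the foliation map and the lapse -/

/-- The foliation map `(t, y) ↦ (t, y) = t ∂ₜ + (0, y)` is jointly smooth. [folklore] -/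
theorem contMDiff_stdFoliation :
    ContMDiff (𝓘(ℝ, ℝ).prod (𝓡 3)) (𝓡 4) ∞ stdFoliation := by
  set L : E3 →L[ℝ] E4 :=
    LinearMap.toContinuousLinearMap (IsLinearMap.mk' _ isLinearMap_ofTimeSpace_zero) with hL
  have hcoe : (L : E3 → E4) = E4.ofTimeSpace 0 := rfl
  have hrep : stdFoliation = fun p : ℝ × slice ↦ p.1 • E4.basisVector 0 + L (p.2 : E3) := by
    funext p
    change E4.ofTimeSpace p.1 (p.2 : E3) = _
    rw [E4.ofTimeSpace_eq_smul_add, hcoe]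
  rw [hrep]
  have h1 : ContMDiff (𝓘(ℝ, ℝ).prod (𝓡 3)) 𝓘(ℝ, ℝ) ∞ (fun p : ℝ × slice ↦ p.1) := contMDiff_fst
  have h2 : ContMDiff (𝓘(ℝ, ℝ).prod (𝓡 3)) (𝓡 3) ∞ (fun p : ℝ × slice ↦ (p.2 : E3)) :=
    contMDiff_subtype_val.comp contMDiff_snd
  have h3 : ContMDiff (𝓘(ℝ, ℝ).prod (𝓡 3)) 𝓘(ℝ, E4) ∞ (fun p : ℝ × slice ↦ L (p.2 : E3)) :=
    L.contDiff.comp_contMDiff h2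
  exact (h1.smul contMDiff_const).add h3

/-- The flow lines `s ↦ (s, y)` have velocity `∂ₜ`. [folklore] -/
theorem mfderiv_flowLine_apply (t : ℝ) (y : slice) :
    mfderiv 𝓘(ℝ, ℝ) (𝓡 4) (fun s : ℝ ↦ stdFoliation (s, y)) t 1 = E4.basisVector 0 := by
  have hrep : (fun s : ℝ ↦ stdFoliation (s, y)) = fun s : ℝ ↦ s • E4.basisVector 0 + sliceEmbed y := by
    funext s
    rw [leaf_eq_sliceEmbed_add, add_comm]
  have hd : HasFDerivAt (fun s : ℝ ↦ s • E4.basisVector 0 + sliceEmbed y)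
      ((ContinuousLinearMap.id ℝ ℝ).smulRight (E4.basisVector 0)) t :=
    ((hasFDerivAt_id t).smul_const (E4.basisVector 0)).add_const _
  change mfderiv 𝓘(ℝ, ℝ) 𝓘(ℝ, E4) (fun s : ℝ ↦ stdFoliation (s, y)) t 1 = _
  rw [hrep, mfderiv_eq_fderiv, hd.fderiv]
  exact one_smul ℝ (E4.basisVector 0)

/-- **The lapse of the standard foliation is `1`**: `N = -η(∂ₜ, ∂ₜ) = 1`.
Christodoulou–Klainerman 1993, Introduction, (1.0.1). [cite: ChristodoulouKlainerman1993, Introduction (1.0.1)] -/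
theorem lapseOf_std (t : ℝ) (y : slice) : spacetime.lapseOf stdFoliation stdNormals t y = 1 := by
  rw [Spacetime.lapseOf_def]
  change -smoothMetric.val (stdFoliation (t, y))
    (mfderiv 𝓘(ℝ, ℝ) (𝓡 4) (fun s : ℝ ↦ stdFoliation (s, y)) t 1) (stdNormals t y) = 1
  rw [mfderiv_flowLine_apply, stdNormals_apply, smoothMetric_val]
  have h : -(bilin (E4.basisVector 0) (E4.basisVector 0)) = (1 : ℝ) := by
    rw [bilin_basisVector_zero]; norm_num
  exact h

/-! ### The two predicates of the crux at Minkowski space -/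

/-- **The standard foliation of Minkowski space is a normalised maximal Cauchy foliation**
(`Spacetime.IsNormalisedMaximalFoliation`): jointly smooth; leaves smoothly embedded Cauchy
hypersurfaces `{x⁰ = t}` with future unit normal `∂ₜ`; induced data the trivial data — maximal,
complete, asymptotically flat of order `1` on the sole end; lapse `≡ 1 > 0`, `→ 1` at infinity.
Christodoulou–Klainerman 1993, Introduction, (1.0.1), (1.0.10)–(1.0.13) (the case of Minkowski
space itself); Hawking–Ellis 1973, §6.5. [cite: ChristodoulouKlainerman1993, Introduction (1.0.1) and (1.0.10)–(1.0.13)] -/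
theorem isNormalisedMaximalFoliation_std :
    spacetime.IsNormalisedMaximalFoliation stdFoliation stdNormals := by
  refine ⟨contMDiff_stdFoliation, isSmoothEmbedding_leaf, isCauchyHypersurface_leaf,
    isFutureUnitNormal_leaf, fun t ↦ ?_, fun t y ↦ ?_, fun t _ ↦ ?_⟩
  · refine ⟨trivialData, leaf_induced_h t, fun {inst} y ↦ ?_,
      trivialData_isTimeSymmetric.isMaximalData, fun {_} ↦ isComplete_trivialData_holds,
      trivialAFEnd, isSoleEnd_trivialAFEnd, isAsymptoticallyFlat_one_trivialData⟩
    haveI : smoothMetric.toPseudoRiemannianMetric.HasLeviCivita := inst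
    exact leaf_induced_k t y
  · rw [lapseOf_std]
    exact one_pos
  · simp_rw [lapseOf_std]
    exact tendsto_const_nhds

/-- **The lapse wells of the standard foliation are trapped** (`Spacetime.HasTrappedWells`),
vacuously with `ε = 1/2`: the lapse is `1` everywhere, so no point has lapse `< 1/2`.
Beig–Ó Murchadha 1998, §IV (nothing collapses in Minkowski space). [cite: BeigMurchadha1998, §IV] -/
theorem hasTrappedWells_std : spacetime.HasTrappedWells stdFoliation stdNormals := by
  refine ⟨1 / 2, by norm_num, 0, fun t y _ hN ↦ ?_⟩
  rw [lapseOf_std] at hN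
  norm_num at hN

/-! ### The crux at the Minkowski development -/

/-- **The matrix of the crux `SettlingInMaximalGauge` holds at the Minkowski development** for
EVERY candidate foliation `(F, ν)`: its conclusion does not mention `(F, ν)` and is the re-typed
settle clause, which holds at Minkowski space by the honest `N = 0` decomposition of
`{x⁰ ≥ 0} = exteriorOf` (`settlesT2_minkowski`: rays stay, charts exhaust, future-oriented).
Christodoulou–Klainerman 1993, Thm. 1.0.2 (trivial case). [cite: ChristodoulouKlainerman1993, Thm. 1.0.2] -/
theorem settlingInMaximalGauge_minkowski
    (F : ℝ × slice → Minkowski.vacuumCauchyDevelopment.carrier)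
    (ν : ∀ t : ℝ, NormalField (𝓡 4) (fun y : slice ↦ F (t, y))) :
    Minkowski.vacuumCauchyDevelopment.IsNormalisedMaximalFoliation F ν →
    Minkowski.vacuumCauchyDevelopment.HasTrappedWells F ν →
    ∃ (O : Set Minkowski.vacuumCauchyDevelopment.carrier)
      (d : FinalStateDecomposition Minkowski.vacuumCauchyDevelopment.toSpacetime O 2),
      O = _root_.Summit.FinalStateConjecture.exteriorOf
            Minkowski.vacuumCauchyDevelopment.toCauchyDevelopment d.charted ∧
        _root_.Summit.FinalStateConjecture.RaysStayInClosure
            Minkowski.vacuumCauchyDevelopment.toCauchyDevelopment O ∧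
          _root_.Summit.FinalStateConjecture.HasExhaustiveCharts d ∧
            _root_.Summit.FinalStateConjecture.IsFutureOriented d := by
  intro _ _
  obtain ⟨-, O, d, -, hO, hrays, hex, hfo⟩ := ChannelsResolveTameDevelopmentsR.TrivialDatum.settlesT2_minkowski
  exact ⟨O, d, hO, hrays, hex, hfo⟩

/-- **Every hypothesis of the crux AND its conclusion hold simultaneously at one certified
maximal development** (given the Choquet-Bruhat–Geroch fact `choquetBruhat_geroch_exists_mghd_cauchy`
for maximality): the trivial datum is admissible, Minkowski space is its MGHD with complete
`𝓘⁺`, the standard foliation is a normalised maximal Cauchy foliation with trapped wells, and the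
conclusion holds. The hypothesis block of `SettlingInMaximalGauge` is therefore kernel-checked
consistent (not vacuous) and consistent with its conclusion at the degenerate instance `N = 0`.
[cite: ChristodoulouKlainerman1993, Thm. 1.0.2] -/
theorem cruxHypotheses_minkowski (hcbg : choquetBruhat_geroch_exists_mghd_cauchy) :
    trivialData ∈ admissibleVacuumData slice ∧ Minkowski.vacuumCauchyDevelopment.IsMaximal ∧
      _root_.Summit.FinalStateConjecture.HasCompleteNullInfinity
          Minkowski.vacuumCauchyDevelopment.toCauchyDevelopment ∧
        Minkowski.vacuumCauchyDevelopment.IsNormalisedMaximalFoliation stdFoliation stdNormals ∧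
          Minkowski.vacuumCauchyDevelopment.HasTrappedWells stdFoliation stdNormals ∧
            ∃ (O : Set Minkowski.vacuumCauchyDevelopment.carrier)
              (d : FinalStateDecomposition Minkowski.vacuumCauchyDevelopment.toSpacetime O 2),
              O = _root_.Summit.FinalStateConjecture.exteriorOf
                    Minkowski.vacuumCauchyDevelopment.toCauchyDevelopment d.charted ∧
                _root_.Summit.FinalStateConjecture.RaysStayInClosure
                    Minkowski.vacuumCauchyDevelopment.toCauchyDevelopment O ∧
                  _root_.Summit.FinalStateConjecture.HasExhaustiveCharts d ∧
                    _root_.Summit.FinalStateConjecture.IsFutureOriented d :=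
  ⟨trivialData_mem_admissibleVacuumData, Minkowski.isMaximal_vacuumCauchyDevelopment hcbg,
    WeakCosmicCensorshipMGHD.Negative.minkowski_hasCompleteNullInfinity,
    isNormalisedMaximalFoliation_std, hasTrappedWells_std,
    settlingInMaximalGauge_minkowski stdFoliation stdNormals isNormalisedMaximalFoliation_std
      hasTrappedWells_std⟩

/-- **The crux BY NAME accepts the Minkowski witnesses**: feeding `SettlingInMaximalGauge` the
slice `X = ℝ³`, the trivial datum, the Minkowski development and the standard foliation
type-checks — its inline hypothesis clauses are met DEFINITIONALLY by
`isNormalisedMaximalFoliation_std` / `hasTrappedWells_std` (the crux's own binders, instances,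
models `𝓡 3`/`𝓡 4` and smoothness exponents included), so the universally quantified crux has a
non-vacuous instance at which it is moreover true (`settlingInMaximalGauge_minkowski`).
[cite: ChristodoulouKlainerman1993, Thm. 1.0.2] -/
theorem settlingInMaximalGauge_apply_minkowski (h : Theses.LapseTrumpetKID.SettlingInMaximalGauge)
    (hmax : Minkowski.vacuumCauchyDevelopment.IsMaximal)
    (hscri : _root_.Summit.FinalStateConjecture.HasCompleteNullInfinity
      Minkowski.vacuumCauchyDevelopment.toCauchyDevelopment) :
    ∃ (O : Set Minkowski.vacuumCauchyDevelopment.carrier)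
      (d : FinalStateDecomposition Minkowski.vacuumCauchyDevelopment.toSpacetime O 2),
      O = _root_.Summit.FinalStateConjecture.exteriorOf
            Minkowski.vacuumCauchyDevelopment.toCauchyDevelopment d.charted ∧
        _root_.Summit.FinalStateConjecture.RaysStayInClosure
            Minkowski.vacuumCauchyDevelopment.toCauchyDevelopment O ∧
          _root_.Summit.FinalStateConjecture.HasExhaustiveCharts d ∧
            _root_.Summit.FinalStateConjecture.IsFutureOriented d :=
  h slice trivialData trivialData_mem_admissibleVacuumData _ hmax hscri stdFoliation stdNormals
    isNormalisedMaximalFoliation_std hasTrappedWells_std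

end Summit.FinalStateConjecture.FinalStateConjecture.Theorems.SettlingInMaximalGauge.Negative

end
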